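/-
Copyright: the b2b-balaban cell (near-miss cell 7), T⁴-continuum fan-out; row NE7b ROUND-2 swarm, seat
t4-ne7b-formalise-leaf-05 gen 10 (row S12o «CONCAVE ENTROPY REPAIR» of `t4/b2b-balaban-t4-ne7b-p1/LEAVES-NE7b.md`, part
(ii) «THE WIRING», file 1∕4; owner's ruling R-OWNER-23-15 and division of labour, journal l.17861 ∕ l.17953; CLAIM
l.17968).  Released under the licence of the surrounding project.
-/
import Summits.QuantumFields.BalabanUV.T4Continuum.Support.HistoryJoinsEnd
import Summits.QuantumFields.BalabanUV.T4Continuum.Support.HistoryJoinsEntropyBudgetPivot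

/-!
# History joins, part 8′: the END IN THE CONSUMER'S SHAPE OVER THE PIVOT BUDGET — `(1 + log κM)` for `(2 + κM)`
# (row S12o part (ii), file 1∕4)

Summits-side support leaf of the T⁴-continuum cell (rung (B)+1 on a FINITE torus only; NOT infinite volume, NOT the
mass gap, NOT the Clay statement; NOT a proof of the spine estimate NE7b).  Row NE7b, route «COUNT»; smallness-census
rows S12n ∕ S12o.  SIBLING of part 8 (`HistoryJoinsEnd`, leaf-05 gen 2) and of its slack form
(`HistoryJoinsSupEnd.card_S_le_exp_pow_slack`, leaf-02 gen 4): the SAME binders, the SAME displayed laws and class-linear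
inputs, ONE input more (`1 ≤ κM`) and ONE budget changed — part 7′'s PIVOT budget (`HistoryJoinsEntropyBudgetPivot`,
leaf-09 g9, row S12o (i-b): `card_S_le_budgetP`, `budgetP_le_of_linear`, over leaf-10 g12's `HistoryJoinsBudgetPivot`,
row S12o (i)) at the pivot `W := κM` in place of part 7's `budgetE`.  [folklore] real arithmetic over the lineage's own
carrier; nothing is quoted from print, nothing printed is asserted, no `[cite:]` tag, no `Prop` fact, no definition, no
constant of print; no landed file is edited; no END of record ∕ exit ∕ socket ∕ `HistoryConstants*` file is touched (c3).

WHY (finding F-leaf10g12-1, census of record `HOME/b2b-balaban-t4-ne7b-formalise-leaf-10/g12/CENSUS-THETA-S12n.md`,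
R-OWNER-23-15 (1)).  Part 8's exponent `(2 + κM + κρ + κE)·F` carries the class-linear MASS constant `κM` itself because
part 7 linearises `n·log(Q∕n) ≤ Q − n` pointwise.  Part 7′ telescopes the concave form `K·log Z − log K! ≤ K·log W + Z∕W`
instead; with `mrg ≤ F` (part 8's `mrg_le_bsum`), `MS ≤ κM·F` and the pivot `W := κM ≥ 1` the mass exponent is
`(1 + log κM)·F`.  This file is the END-level consumer of that step; the radius-side repair (`κρ`, row S12o (i-c),
leaf-10 g12's `HistoryJoinsPlacedOmega`) enters only through the UNCHANGED abstract input `hMρP : MρP ≤ exp(κρ·F)` and is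
wired in file 2∕4 (`HistoryJoinsPlacedEndConcave`).

WHAT.
* **`card_S_le_exp_pow_slack'`** — the slack END over the pivot budget: under part 8's displayed zone laws `hcard` ∕
  `hloc` ∕ `hNZ` ∕ `hNZle` and the inputs `MS ≤ κM·F` (`1 ≤ κM`), `MρP ≤ exp(κρ·F)`, `ENT ≤ κE·F + μE·partnerAges + Ξ`:
  `#S G z ≤ exp((1 + log κM + κρ + κE)·F + Ξ) · (Λ·e^{μE})^{partnerAges st G}`;
* **`card_S_le_exp_pow'`** — the same without slack (`Ξ = 0`), part 8's statement shape with the new exponent;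
* `exponent'_le_exponent` — the new exponent never exceeds part 8's (`1 + log κ ≤ κ` for `κ ≥ 1`; bookkeeping, so that
  every consumer of part 8 may switch without loss);
* §3 sanity (`norm_num` ∕ decided instances; numerals here only, nothing of print).

HONEST SCOPE.  A sharper bookkeeping END for OUR count; the displayed hypotheses are exactly part 8's plus `1 ≤ κM`;
which END the instance ∕ apex files quote is decided downstream (files 2–4 of part (ii), then leaf-08 g11's part (iii));
the headline's Prop (`ContinuumYM4Torus D`, p224237) is unchanged by any of this — only the size of an ∃-bound coupling
threshold moves.  NE7b NOT proved; spine 0∕9.  HONEST DEPENDENCY (cell): continuum YM on T⁴ ⇐ BetaPertH ∧ nine spine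
estimates (0/9 proved); BetaPertH ⇐ (D1) ∧ (D4) ∧ CAP+tail; G-an2-4 gates asym, D1 and NE2/3/4.  This file changes
none of it.
-/

open Finset
open Literature.MathematicalPhysics.QuantumFieldTheory.Balaban1983to89
open T4PersistenceDictionary T4PartnerMultiplicity T4BranchingRecordsGas
open Summit.QuantumFields.BalabanUV.T4Continuum.HistoryJoins
open Summit.QuantumFields.BalabanUV.T4Continuum.HistoryJoinsAdm
open Summit.QuantumFields.BalabanUV.T4Continuum.HistoryJoinsCount
open Summit.QuantumFields.BalabanUV.T4Continuum.HistoryJoinsTotal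
open Summit.QuantumFields.BalabanUV.T4Continuum.HistoryJoinsBudget
open Summit.QuantumFields.BalabanUV.T4Continuum.HistoryJoinsEntropyBudget
open Summit.QuantumFields.BalabanUV.T4Continuum.HistoryJoinsEntropyBudgetPivot
open Summit.QuantumFields.BalabanUV.T4Continuum.HistoryJoinsEnd

namespace Summit.QuantumFields.BalabanUV.T4Continuum.HistoryJoinsEndConcave

noncomputable section

open scoped Classical

/-! ## §1 The exponent comparison -/

/-- `1 + log κ ≤ κ` for `κ ≥ 1` (`log x ≤ x − 1`). [folklore] -/
theorem one_add_log_le {κ : ℝ} (hκ : 1 ≤ κ) : 1 + Real.log κ ≤ κ := by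
  have := Real.log_le_sub_one_of_pos (zero_lt_one.trans_le hκ)
  linarith

/-- **THE NEW EXPONENT NEVER EXCEEDS PART 8's**: `(1 + log κM + κρ + κE)·F ≤ (2 + κM + κρ + κE)·F` for `κM ≥ 1`, `F ≥ 0`.
[folklore] -/
theorem exponent'_le_exponent {κM κρ κE F : ℝ} (hκ : 1 ≤ κM) (hF : 0 ≤ F) :
    (1 + Real.log κM + κρ + κE) * F ≤ (2 + κM + κρ + κE) * F :=
  mul_le_mul_of_nonneg_right (by linarith [one_add_log_le hκ]) hF

/-! ## §2 The END in the consumer's shape over the pivot budget -/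

section End

variable {ε γ β R : Type*} [DecidableEq β] [LinearOrder R] [Fintype γ] {D : ℕ}
  (st : ε → ℕ) (M : ℕ → Gen ε → ℕ) (ext : ℕ → Gen ε → ℝ) (NZ : ℝ → ℕ → ℕ → ℕ) (Mρ : ℝ → ℝ)

/-- **ROW S12o (ii) — THE END WITH AN ENTROPY SLACK OVER THE PIVOT BUDGET.**  For every shape tree `G` and root cell
`z`, with `F := Σ_births (fat + 1)`: under part 8's displayed zone laws (cardinality `hcard`, root locality `hloc`,
one-block root count `hNZ` with fibre `hNZle : NZ ≤ Mρ·Λ^{t+1−s}`) and the class-linear inputs `MS ≤ κM·F` with `1 ≤ κM`,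
`MρP ≤ exp(κρ·F)`, `ENT ≤ κE·F + μE·partnerAges + Ξ`,
`#S G z ≤ exp((1 + log κM + κρ + κE)·F + Ξ)·(Λ·e^{μE})^{partnerAges st G}`
— the binders of `HistoryJoinsSupEnd.card_S_le_exp_pow_slack` VERBATIM plus `hκM`, the exponent's `2 + κM` replaced by
`1 + log κM` (part 7′'s `card_S_le_budgetP` at the pivot `κM`, `budgetP_le_of_linear`). [folklore] -/
theorem card_S_le_exp_pow_slack'
    (zone : ℕ → Gen ε → (Addr D → γ) → Finset β) (ρ : (Addr D → γ) → R) (c₀ : γ)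
    (near : β → ℕ → γ → ℕ → ℝ → Prop)
    (hcard : ∀ (t : ℕ) (Z : Gen ε) (p : Addr D → γ), p ∈ Sany zone ρ c₀ st Z → (zone t Z p).card ≤ M t Z)
    (hloc : ∀ (t : ℕ) (Z : Gen ε) (p : Addr D → γ) (u : β), p ∈ Sany zone ρ c₀ st Z → u ∈ zone t Z p →
      near u t (evalA c₀ p (rootAddr Z)) Z.rootStep (ext t Z))
    (hNZ : ∀ (u : β) (t s : ℕ) (r : ℝ), (univ.filter fun y : γ => near u t y s r).card ≤ NZ r t s)
    {Λ : ℝ} (hΛ : 0 ≤ Λ) (hMρ0 : ∀ r, 0 ≤ Mρ r) (hNZle : ∀ (r : ℝ) (t s : ℕ), (NZ r t s : ℝ) ≤ Mρ r * Λ ^ (t + 1 - s))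
    (fat : ε → ℕ) (G : Gen ε) {κM κρ κE μE Ξ : ℝ} (hκM : 1 ≤ κM)
    (hMS : MS st M G ≤ κM * bsum (fun b => (fat b : ℝ) + 1) G)
    (hMρP : MρP st ext Mρ G ≤ Real.exp (κρ * bsum (fun b => (fat b : ℝ) + 1) G))
    (hENT : ENT st G ≤ κE * bsum (fun b => (fat b : ℝ) + 1) G + μE * partnerAges st G + Ξ) (z : γ) :
    ((S zone ρ c₀ st G z).card : ℝ) ≤
      Real.exp ((1 + Real.log κM + κρ + κE) * bsum (fun b => (fat b : ℝ) + 1) G + Ξ) *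
        (Λ * Real.exp μE) ^ partnerAges st G := by
  set F := bsum (fun b => (fat b : ℝ) + 1) G
  set pa := partnerAges st G
  have hκ0 : 0 < κM := zero_lt_one.trans_le hκM
  have h0 := card_S_le_budgetP st M ext NZ zone ρ c₀ near hcard hloc hNZ hκ0 G z
  have hmrg : mrg st G ≤ F := by linarith [mrg_le_bsum st fat G]
  have h1 := budgetP_le_of_linear st M ext NZ hκM G hmrg hMS
  have hNZP := NZP_le_pow st ext NZ Mρ hΛ hMρ0 hNZle G
  have hexp : Real.exp ((Real.log κM + 1) * F + ENT st G) ≤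
      Real.exp ((1 + Real.log κM + κE) * F + μE * pa + Ξ) := by
    refine Real.exp_le_exp.2 ?_
    nlinarith [hENT]
  calc ((S zone ρ c₀ st G z).card : ℝ) ≤ budgetP st M ext NZ κM G := h0
    _ ≤ Real.exp ((Real.log κM + 1) * F + ENT st G) * NZP st ext NZ G := h1
    _ ≤ Real.exp ((1 + Real.log κM + κE) * F + μE * pa + Ξ) * (MρP st ext Mρ G * Λ ^ pa) :=
        mul_le_mul hexp hNZP (NZP_nonneg st ext NZ G) (Real.exp_pos _).le
    _ ≤ Real.exp ((1 + Real.log κM + κE) * F + μE * pa + Ξ) * (Real.exp (κρ * F) * Λ ^ pa) :=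
        mul_le_mul_of_nonneg_left (mul_le_mul_of_nonneg_right hMρP (pow_nonneg hΛ _)) (Real.exp_pos _).le
    _ = Real.exp ((1 + Real.log κM + κρ + κE) * F + Ξ) * (Λ * Real.exp μE) ^ pa := by
        rw [mul_pow, ← Real.exp_nat_mul, ← mul_assoc, ← Real.exp_add, mul_comm (Λ ^ pa), ← mul_assoc,
          ← Real.exp_add]
        congr 2
        ring

/-- **ROW S12o (ii) — THE END IN THE CONSUMER'S SHAPE OVER THE PIVOT BUDGET** (no slack): part 8's
`HistoryJoinsEnd.card_S_le_exp_pow` with the binder `hκM : 1 ≤ κM` added and the exponent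
`(1 + log κM + κρ + κE)·F` in place of `(2 + κM + κρ + κE)·F`. [folklore] -/
theorem card_S_le_exp_pow'
    (zone : ℕ → Gen ε → (Addr D → γ) → Finset β) (ρ : (Addr D → γ) → R) (c₀ : γ)
    (near : β → ℕ → γ → ℕ → ℝ → Prop)
    (hcard : ∀ (t : ℕ) (Z : Gen ε) (p : Addr D → γ), p ∈ Sany zone ρ c₀ st Z → (zone t Z p).card ≤ M t Z)
    (hloc : ∀ (t : ℕ) (Z : Gen ε) (p : Addr D → γ) (u : β), p ∈ Sany zone ρ c₀ st Z → u ∈ zone t Z p →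
      near u t (evalA c₀ p (rootAddr Z)) Z.rootStep (ext t Z))
    (hNZ : ∀ (u : β) (t s : ℕ) (r : ℝ), (univ.filter fun y : γ => near u t y s r).card ≤ NZ r t s)
    {Λ : ℝ} (hΛ : 0 ≤ Λ) (hMρ0 : ∀ r, 0 ≤ Mρ r) (hNZle : ∀ (r : ℝ) (t s : ℕ), (NZ r t s : ℝ) ≤ Mρ r * Λ ^ (t + 1 - s))
    (fat : ε → ℕ) (G : Gen ε) {κM κρ κE μE : ℝ} (hκM : 1 ≤ κM)
    (hMS : MS st M G ≤ κM * bsum (fun b => (fat b : ℝ) + 1) G)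
    (hMρP : MρP st ext Mρ G ≤ Real.exp (κρ * bsum (fun b => (fat b : ℝ) + 1) G))
    (hENT : ENT st G ≤ κE * bsum (fun b => (fat b : ℝ) + 1) G + μE * partnerAges st G) (z : γ) :
    ((S zone ρ c₀ st G z).card : ℝ) ≤
      Real.exp ((1 + Real.log κM + κρ + κE) * bsum (fun b => (fat b : ℝ) + 1) G) *
        (Λ * Real.exp μE) ^ partnerAges st G := by
  have h := card_S_le_exp_pow_slack' st M ext NZ Mρ zone ρ c₀ near hcard hloc hNZ hΛ hMρ0 hNZle fat G (Ξ := 0) hκM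
    hMS hMρP (by rw [add_zero]; exact hENT) z
  rwa [add_zero] at h

/-- **NO LOSS AGAINST PART 8**: under the same inputs the new bound implies part 8's slack bound (so consumers may switch
freely). [folklore] -/
theorem card_S_le_exp_pow_slack_of_slack'
    (zone : ℕ → Gen ε → (Addr D → γ) → Finset β) (ρ : (Addr D → γ) → R) (c₀ : γ) (G : Gen ε) (fat : ε → ℕ)
    {κM κρ κE μE Ξ Λ : ℝ} (hκM : 1 ≤ κM) (hΛ : 0 ≤ Λ) (z : γ)
    (h : ((S zone ρ c₀ st G z).card : ℝ) ≤
      Real.exp ((1 + Real.log κM + κρ + κE) * bsum (fun b => (fat b : ℝ) + 1) G + Ξ) *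
        (Λ * Real.exp μE) ^ partnerAges st G) :
    ((S zone ρ c₀ st G z).card : ℝ) ≤
      Real.exp ((2 + κM + κρ + κE) * bsum (fun b => (fat b : ℝ) + 1) G + Ξ) *
        (Λ * Real.exp μE) ^ partnerAges st G := by
  refine h.trans (mul_le_mul_of_nonneg_right (Real.exp_le_exp.2 ?_) (pow_nonneg (mul_nonneg hΛ (Real.exp_pos _).le) _))
  have hF : 0 ≤ bsum (fun b => (fat b : ℝ) + 1) G := bsum_nonneg (fun b => by positivity) G
  linarith [exponent'_le_exponent (κρ := κρ) (κE := κE) hκM hF]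

end End

/-! ## §3 Sanity (numerals here only; nothing of print) -/

namespace Sanity

/-- the exponent comparison at `κM = exp 56`: slope `57 + κρ + κE` against part 8's `2 + exp 56 + κρ + κE`. -/
example {κρ κE F : ℝ} : (1 + Real.log (Real.exp 56) + κρ + κE) * F = (57 + κρ + κE) * F := by
  rw [Real.log_exp]; ring

/-- … and the comparison lemma at a small pivot `κM = 1`: `1 + log 1 = 1 ≤ 2 + 1`. -/
example : (1 : ℝ) + Real.log 1 ≤ 1 := by rw [Real.log_one, add_zero]

/-- the comparison is an instance of `exponent'_le_exponent` (checked through the lemma, not numerically) -/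
example {F : ℝ} (hF : 0 ≤ F) : (1 + Real.log 3 + 5 + 7) * F ≤ (2 + 3 + 5 + 7) * F :=
  exponent'_le_exponent (by norm_num) hF

end Sanity

end

end Summit.QuantumFields.BalabanUV.T4Continuum.HistoryJoinsEndConcave
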